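import Literature.MathematicalPhysics.QuantumFieldTheory.Balaban1983to89.B9Eq3130GtildeMinusG1kRowsClosed
import Literature.MathematicalPhysics.QuantumFieldTheory.Balaban1983to89.B9Eq3147MiddleWordSupRowClosed

/-!
# `Balaban1983to89.B9Eq3132QGtildeQInvLetterClosed` — T. Bałaban, *Propagators for lattice gauge theories in a background field*, Commun. Math. Phys. **99** (1985)
# 389–434 [Balaban1985BackgroundPropagators] (3.132) p. 422 (*«The operators (QGQ*)⁻¹, or (QG₁Q*)⁻¹, can be analyzed in the same way as the operator (Q′G′²Q′*)⁻¹. We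
# will not repeat these considerations here, let us write only bounds (3.132)»*), (3.126) p. 420, (3.130) p. 421, Thm 3.11 p. 416: **THE LOCAL SUP LETTER OF
# `(Q_kG̃_kQ_k†)⁻¹` ON THE CELL's MODEL, ∃-FIRST, HEIGHT-FREE — by a NEUMANN SERIES AROUND `(Q_kG1kQ_k†)⁻¹`** (the NE9 owner's RULING R-ne9p1-g97-4 (2)(b), journal
# `HOME/CLAIMS.log` l.66556: the one non-verbatim input of the `H̃_k = G̃_kQ_k†(Q_kG̃_kQ_k†)⁻¹` pair; print analyses `(QGQ*)⁻¹` directly, the cell perturbs)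

statement-level skeleton of published theorems with citation tags; proofs where landed; nothing here is a claim about the Yang–Mills mass gap

CITATION HEADER (lean-in-tree rule).  Audit cell `pub-balaban`, sub-cell `t4`, BINDER row NE9; NE9 crux-team LEAF PROVER 05 (`b2b-balaban-t4-ne9-formalise-leaf-05`, gen 88;
(K80)).  Composed BY NAME: `KinvLatticeK hposπ hQ = (Q_kG̃_kQ_k†)⁻¹` and `KinvLatticeK hpos hQ = (Q_kG1kQ_k†)⁻¹` (`B11Eq103H1Complex`, the SAME constructor at the two
Hessian slots), the identity `K̃ = K₀ + K₀(Q_k(G1k − G̃_k)Q_k†)K̃` (`hK_lattice` at `hposπ` + `greenK_apply` at `hpos`), the landed block decay of `K₀`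
(`B9Eq3126QG1QInvPointDecayTowerDiagonalClosed.exists_bondPoint_decay_Kinv_diagonal_closed`) read as a letter by (K65)'s `letter_Kinv_of_block_decay`, the `Q_k†` ∕ `Q_k`
letters exactly as in (K65) `B9Eq3126H1kSupRowClosed` ∕ (K66) `B9Eq3147MiddleWordSupRowClosed` (`norm_adjoint_QkW_apply_le_local_sharp`, `norm_equiv_QkW_apply_le_blocks`,
`QkOfU_apply_eq_zero_of_support`, `letter_of_range`), (K79) `exists_local_letters_G1LatticeKPi_sub_G1k` (the `O(j₀)` difference), (K61) `letter_comp`, (K71)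
`letter_of_neumann'`.  Source READ first-hand (`paper:balaban1985-cmp99-background-propagators`, PDF + 388): pp. 416, 420–422.  [folklore] letter algebra; NOTHING of
print's (3.132) ∕ Thm 3.11 ∕ 3.13 is asserted, valued or discharged.
WHAT IS PROVED (sorry-free; no `def`).  **`exists_local_letter_KinvLatticeKPi`**: `∃ (α₁, j₁, B, δ)` BEFORE (K79)'s binder block (+ `hαL`, the `Q_k`-onto window of (K65),
+ ANY surjectivity witness `hQ`) such that for every coarse-bond field `z` supported over the bonds based at `v` with `‖z‖_∞ ≤ F` and every coarse bond `b′`: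
`‖((Q_kG̃_kQ_k†)⁻¹z)(b′)‖ ≤ B·e^{−δ·d_m(b′₋, v)}·F` — `B = 2·A_K·√d`, `δ = κ∕4`, `κ = min(δ_K79, r₁)`, `j₁` shrunk so that the Neumann ratio is `≤ ½`.
HONEST SCOPE.  `hpos′`, `hpos`, `hposπ`, `hQ`, the windows, E162's data, `c₀ = η^d`, `‖J‖ ≤ j₀` stay HYPOTHESES; constants crude; «NE9 ⇐ the named binders»; NE9 NOT
PRINTED ∕ NOT PROVED; row WALLED ON A MODEL (O-NE9-1; #5 UNRULED); spine PROVED 0∕9; rung (B)+1 on a finite T⁴ — NOT infinite volume, NOT mass gap, NOT BetaPertH, NOT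
Clay.  HONEST DEPENDENCY: continuum YM on T⁴ ⇐ BetaPertH ∧ nine spine estimates (0/9 proved); BetaPertH ⇐ (D1) ∧ (D4) ∧ CAP+tail; G-an2-4 gates asym, D1 and NE2/3/4.
NEW file importing (K79) and (K66); nothing modified.  Net new unproved facts: 0.
-/

noncomputable section

set_option autoImplicit false

open scoped InnerProductSpace ComplexConjugate BigOperators

namespace Literature.MathematicalPhysics.QuantumFieldTheory.Balaban1983to89.B9Eq3132QGtildeQInvLetterClosed


open B4Sect5Torus (TSite tdist tdist_nonneg tdist_symm tdist_self tdist_triangle torusSum_le)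
open B4Sect5Proof (latticeConst latticeConst_nonneg)
open B9SectCLatticeCarrier (Bond DirPair bpos btgt shift unshift)
open B9Eq311L2Pairing (WL2)
open B9Eq319QprimeTorus (fineP blockCoord)
open B7Prop1Explicit (U1 Wcx boxVec)
open B11Eq103H1Complex (SiteL2K BondL2K greenK greenK_apply covDerivL2K covDivL2K G1LatticeK KinvLatticeK hK_lattice)
open B9Eq310DeltaPrime (plaqHolU)
open B9Eq310HessianOperator (adTransportW hessOp)
open B9Eq310HessianHermitian (adTransportW_adjoint)
open B9Eq315QTorus (perCfg cornerSite)
open B9Eq315QTower (towerP UlevOf)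
open B9Eq316TowerFlatIsOneStep (towerP_eq_fineP_pow siteCast)
open B9Eq326OperatorTower (QprimeTowerW QkW RofUk laplaceAk G1k)
open B9Eq324DeltaPrimeATower (laplacePrimeAk GpOfUk)
open B9Eq33CovDerivLocalLetterTower (tdist_bigBlock_bpos_btgt_le_one)
open B9Eq3117GaugeModeStencilLettersTower (local_hessOp_covDerivL2K_tower local_covDivL2K_hessOp_tower)
open B9Eq3130GtildeMinusG1kRowsClosed (exists_local_letters_G1LatticeKPi_sub_G1k)
open B9Eq3119DeltaPiTower (piOfUk laplaceAkPi)

variable {d : ℕ} (hd : 1 ≤ d) (L : ℕ) [NeZero L] (hL : 1 ≤ L) (hL3 : 3 ≤ L)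
  {𝔸 : Type*} [NormedRing 𝔸] [NormedAlgebra ℂ 𝔸] [CompleteSpace 𝔸] [NormOneClass 𝔸] [StarRing 𝔸] [NormedStarGroup 𝔸] [StarModule ℂ 𝔸]
  {W : Type*} [NormedAddCommGroup W] [InnerProductSpace ℂ W] [FiniteDimensional ℂ W] (φ : W ≃ₗ[ℂ] 𝔸)
  {Mφ Mφ' : ℝ} (hMφ : 0 ≤ Mφ) (hMφ' : 0 ≤ Mφ') (hφ : ∀ w, ‖φ w‖ ≤ Mφ * ‖w‖) (hφ' : ∀ X, ‖φ.symm X‖ ≤ Mφ' * ‖X‖) (hstar : ∀ X : 𝔸, ‖star X‖ ≤ ‖X‖)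
  {a : ℝ} (ha : 0 < a) {a' : ℝ} (ha' : 0 < a') {ϱ : ℝ} (hϱ0 : 0 ≤ ϱ) (hϱ1 : ϱ < 1)
  (τ : 𝔸 →ₗ[ℂ] ℂ) {Cτ : ℝ} (hτ : ∀ X, ‖τ X‖ ≤ Cτ * ‖X‖) (hCτ : 0 ≤ Cτ) {Mτ : ℝ} (hτm : ∀ X Y : 𝔸, ‖τ (X * Y)‖ ≤ Mτ * ‖X‖ * ‖Y‖) (hMτ : 0 ≤ Mτ)
  {ρw : ℝ} (hρw : 0 ≤ ρw)
  (hτ₁ : ∀ X : 𝔸, τ (star X) = conj (τ X)) (hτ₂ : ∀ X Y : 𝔸, τ (X * Y) = τ (Y * X)) (hφτ : ∀ X Y : 𝔸, ⟪φ.symm X, φ.symm Y⟫_ℂ = τ (star X * Y))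
  (AQ : ℝ)

open B9Eq326G1SupRowOfLetters (letter_comp letter_mono)
open B9Eq3130NeumannLetter (letter_of_neumann')
open B9Eq3126H1SupRowOfLetters (letter_of_range letter_Kinv_of_block_decay)
open B9Eq3126QG1QInvPointDecayTowerDiagonalClosed (exists_bondPoint_decay_Kinv_diagonal_closed)
open B9Eq349BlockMultipliers (exists_block_clm_family)
open B9Eq349BlockDistanceWeight (tdist_shift_le_one)
open B9Eq315QkLocalLetter (QkOfU_apply_eq_zero_of_support)
open B9Eq315QkSingleBondLetter (equiv_QkW_apply norm_adjoint_QkW_apply_le_local_sharp)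
open B9Eq316PenaltyStencilLetterTower (norm_equiv_QkW_apply_le_blocks)
open B9Eq347LocalFromBlockDecay (norm_le_sqrt_mass_mul)
open B9Eq326LocalPartTowerSupDecayDiagonalClosed (sum_bondMass_bigBlock_le)

omit [NeZero L] in
/-- `e^{−r t} ≤ e^{−κ t}` for `κ ≤ r`, `0 ≤ t`. [folklore] -/
private theorem exp_weaken' {r κ t : ℝ} (hκ : κ ≤ r) (ht : 0 ≤ t) : Real.exp (-(r * t)) ≤ Real.exp (-(κ * t)) :=
  Real.exp_le_exp.2 (by nlinarith)

set_option maxHeartbeats 400000 in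
include hd hL hL3 hMφ hMφ' hφ hφ' hstar ha ha' hϱ0 hϱ1 hτ hCτ hτm hMτ hρw hτ₁ hτ₂ hφτ in
/-- **THE LOCAL SUP LETTER OF `K̃ = (Q_kG̃_kQ_k†)⁻¹ = KinvLatticeK hposπ hQ`, ∃-FIRST, HEIGHT-FREE** — Neumann around `K₀ = (Q_kG1kQ_k†)⁻¹`: the identity
`K̃ = K₀ + K₀E′K̃`, `E′ = Q_k(G1k − G̃_k)Q_k†` (from `Q_kG̃_kQ_k†K̃ = 1` and `K₀Q_kG1kQ_k† = 1`); letters (L)(K₀; A_K√d, κ) (block decay → letter), (L)(Q_k†; M_Q†e^κ, κ),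
(L)(Q_k; M_Qe^κ, κ), (L)(G1k − G̃_k; j₀C, κ) ((K79)); two `letter_comp` give (L)(E′; j₀·C_E, κ∕2); (K71) `letter_of_neumann'` at rate `κ∕2 → κ∕4` with ratio
`j₀C_EK′·A_K√d·K′ ≤ ½` inside the window `j₀ ≤ j₁`. [cite: Balaban1985BackgroundPropagators, (3.132) p.422, (3.126) p.420, (3.130) p.421, Thm 3.11 p.416, Thm 3.1 (3.42) p.397]
[cite: Balaban1984PropagatorsII, Lemma 2.1 (2.61) p.234] -/
theorem exists_local_letter_KinvLatticeKPi :
    ∃ α₁ j₁ B δ : ℝ, 0 < α₁ ∧ 0 < j₁ ∧ 0 ≤ B ∧ 0 < δ ∧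
      ∀ (n : ℕ) (η : ℝ) (_hηL : η * (L : ℝ) ^ (n + 1) = 1) (c₀ c₁ : ℝ) [Fact (0 < c₀)] [Fact (0 < c₁)]
        (_hw : c₀ * ((L : ℝ) ^ (n + 1)) ^ d = c₁) (_hρ : |η| ^ d / c₀ ≤ ρw) (m : Fin d → ℕ) [∀ i, NeZero (m i)] (_hm : ∀ i, 1 ≤ m i)
        (U : Bond d (towerP L m (n + 1)) → 𝔸ˣ) (αU : ℕ → ℝ) (_hα0 : ∀ j, 0 ≤ αU j) (hα1 : ∀ j, αU j ≤ 1 / 64)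
        (hαL : ∀ j, 50 * (d + 1) * αU j * (L : ℝ) ^ d ≤ 1 / 2)
        (hU1 : ∀ (j : ℕ) (x : B7Prop1Explicit.Site d) (k : Fin d), perCfg (towerP L m (j + 1)) (UlevOf L m (n + 1) U j) x k ∈ U1 𝔸)
        (hreg : ∀ (j : ℕ) (y : TSite d (towerP L m j)) (k : Fin d) (ρ' : Fin d → Fin L),
          ‖((Wcx L (perCfg (towerP L m (j + 1)) (UlevOf L m (n + 1) U j)) (cornerSite L y) k (boxVec L ρ') : 𝔸ˣ) : 𝔸) - 1‖ ≤ αU j)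
        (εU : ℕ → ℝ) (_hεU : ∀ j, 0 ≤ εU j) (_hUε : ∀ (j : ℕ) (b : Bond d (towerP L m (j + 1))), ‖(UlevOf L m (n + 1) U j b : 𝔸) - 1‖ ≤ εU j)
        (_hLb : ∀ (j : ℕ) (b : Bond d (towerP L m (j + 1))), UlevOf L m (n + 1) U j b ∈ U1 𝔸)
        (α : ℝ) (_hα : 0 ≤ α) (_hαle : α ≤ α₁)
        (hUst : ∀ b, star (U b : 𝔸) = (((U b)⁻¹ : 𝔸ˣ) : 𝔸)) (_hUb : ∀ b, U b ∈ U1 𝔸) (_hUη : ∀ b, ‖(U b : 𝔸) - 1‖ ≤ α * η)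
        (_hpl : ∀ p : B9SectCLatticeCarrier.Plaq d (towerP L m (n + 1)), ‖(plaqHolU U p : 𝔸) - 1‖ ≤ α * η ^ 2)
        (_hUgrad : ∀ (x : TSite d (towerP L m (n + 1))) (μ : Fin d), ‖(U (x, μ) : 𝔸) - U (unshift μ x, μ)‖ ≤ α * η ^ 2)
        (_hRlev : ∀ (j : ℕ) (b : Bond d (towerP L m (j + 1))) (w : W), ‖adTransportW φ (UlevOf L m (n + 1) U j) b w‖ ≤ ‖w‖)
        (_hεg : ∀ j < n + 1, εU j ≤ α * ϱ ^ j) (_hAQ : ∑ j ∈ Finset.range (n + 1), αU j ≤ AQ)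
        (hpos' : ∀ x : SiteL2K ℂ d (towerP L m (n + 1)) c₀ W, x ≠ 0 → 0 < RCLike.re ⟪x, laplacePrimeAk L m n φ η U a' (c₁ := c₁) x⟫_ℂ)
        (hpos : ∀ x : BondL2K ℂ d (towerP L m (n + 1)) c₀ W, x ≠ 0 →
          0 < RCLike.re ⟪x, laplaceAk L m n φ η U hL αU hα1 hU1 hreg τ (c₀ := c₀) (c₁ := c₁) a x⟫_ℂ)
        (_hc₀η : c₀ = η ^ d) (j₀ : ℝ) (_hJ : ∀ μ y, ‖B9Eq39Adjoint.J (fun μ => B9Eq33CovDerivVector.shiftEquiv μ) (fun μ y => U (y, μ)) η μ y‖ ≤ j₀) (_hj : j₀ ≤ j₁)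
        (hposπ : ∀ x : BondL2K ℂ d (towerP L m (n + 1)) c₀ W, x ≠ 0 →
          0 < RCLike.re ⟪x, laplaceAkPi L m n φ τ η U a' hpos' hL αU hα1 hU1 hreg (c₁ := c₁) a x⟫_ℂ)
        (hQ : Function.Surjective (QkW L m n φ U hL αU hα1 hU1 hreg (c₀ := c₀) (c₁ := c₁)))
        (v : TSite d m) (z : BondL2K ℂ d m c₁ W) (F : ℝ)
        (_hzv : ∀ b', bpos b' ≠ v → WL2.equiv ℂ (fun _ : Bond d m => c₁) W z b' = 0)
        (_hzF : ∀ b', ‖WL2.equiv ℂ (fun _ : Bond d m => c₁) W z b'‖ ≤ F) (b' : Bond d m),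
        ‖WL2.equiv ℂ (fun _ : Bond d m => c₁) W (KinvLatticeK hposπ hQ z) b'‖ ≤ B * Real.exp (-(δ * tdist m (bpos b') v)) * F := by
  classical
  obtain ⟨αD, jD, CD, δD, hαD, hjD, hCD, hδD, HD⟩ :=
    exists_local_letters_G1LatticeKPi_sub_G1k hd L hL hL3 φ hMφ hMφ' hφ hφ' hstar ha ha' hϱ0 hϱ1 τ hτ hCτ hτm hMτ hρw hτ₁ hτ₂ hφτ AQ
  obtain ⟨αK, r₁, AK, hαK, hr₁, hAK, HK⟩ :=
    exists_bondPoint_decay_Kinv_diagonal_closed hd L hL hL3 φ hMφ hMφ' hφ hφ' hstar ha ha' hϱ0 hϱ1 τ hτ hCτ hτm hMτ hρw hτ₁ hτ₂ hφτ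
  -- one window, one rate, the constants
  obtain ⟨αs, hαs⟩ : ∃ αs : ℝ, αs = min αD αK := ⟨_, rfl⟩
  have hαs0 : 0 < αs := by rw [hαs]; exact lt_min hαD hαK
  obtain ⟨κ, hκdef⟩ : ∃ κ : ℝ, κ = min δD r₁ := ⟨_, rfl⟩
  have hκ0 : 0 < κ := by rw [hκdef]; exact lt_min hδD hr₁
  have hκD : κ ≤ δD := by rw [hκdef]; exact min_le_left _ _
  have hκK : κ ≤ r₁ := by rw [hκdef]; exact min_le_right _ _
  obtain ⟨K, hKdef⟩ : ∃ K : ℝ, K = latticeConst d (κ - κ / 2) := ⟨_, rfl⟩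
  have hK0 : 0 ≤ K := by rw [hKdef]; exact latticeConst_nonneg d (sub_pos.2 (half_lt_self hκ0)).le
  obtain ⟨K', hK'def⟩ : ∃ K' : ℝ, K' = latticeConst d (κ / 2 - κ / 4) := ⟨_, rfl⟩
  have hK'0 : 0 ≤ K' := by rw [hK'def]; exact latticeConst_nonneg d (by linarith only [hκ0])
  obtain ⟨MQa, hMQa⟩ : ∃ M : ℝ, M = Mφ' * Real.exp (100 * d * (d + 1) * (L : ℝ) ^ d * AQ) * Mφ * ((2 * d : ℕ) : ℝ) := ⟨_, rfl⟩
  have hMQa0 : 0 ≤ MQa := by rw [hMQa]; positivity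
  have h1ϱ : 0 < 1 - ϱ := by linarith only [hϱ1]
  obtain ⟨CQ, hCQ⟩ : ∃ C : ℝ, C = Mφ' * Mφ * Real.exp (Real.sqrt ((L : ℝ) ^ d) * (Real.sqrt (2 * d) * (102 * (d + 1) ^ 2 * L)) * (αs / (1 - ϱ))) := ⟨_, rfl⟩
  have hCQ0 : 0 ≤ CQ := by rw [hCQ]; positivity
  obtain ⟨CE, hCE⟩ : ∃ C : ℝ, C = MQa * Real.exp (κ * 1) * CD * K * (CQ * (2 * Real.sqrt d) * Real.exp (κ * 1)) * K := ⟨_, rfl⟩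
  have hCE0 : 0 ≤ CE := by rw [hCE]; positivity
  obtain ⟨BKc, hBKc⟩ : ∃ B : ℝ, B = AK * Real.sqrt d := ⟨_, rfl⟩
  have hBKc0 : 0 ≤ BKc := by rw [hBKc]; positivity
  obtain ⟨P, hP⟩ : ∃ P : ℝ, P = CE * K' * BKc * K' := ⟨_, rfl⟩
  have hP0 : 0 ≤ P := by rw [hP]; positivity
  obtain ⟨j₁, hj₁⟩ : ∃ j₁ : ℝ, j₁ = min (min 1 jD) (1 / (2 * (P + 1))) := ⟨_, rfl⟩
  have hj₁0 : 0 < j₁ := by rw [hj₁]; exact lt_min (lt_min one_pos hjD) (by positivity)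
  have hj₁1 : j₁ ≤ 1 := by rw [hj₁]; exact (min_le_left _ _).trans (min_le_left _ _)
  have hj₁D : j₁ ≤ jD := by rw [hj₁]; exact (min_le_left _ _).trans (min_le_right _ _)
  have hj₁P : j₁ * P ≤ 1 / 2 := by
    have h : j₁ ≤ 1 / (2 * (P + 1)) := by rw [hj₁]; exact min_le_right _ _
    calc j₁ * P ≤ 1 / (2 * (P + 1)) * P := mul_le_mul_of_nonneg_right h hP0
      _ ≤ 1 / (2 * (P + 1)) * (P + 1) := mul_le_mul_of_nonneg_left (by linarith only [hP0]) (by positivity)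
      _ = 1 / 2 := by field_simp
  have hW0 : 0 ≤ Real.sqrt ((L : ℝ) ^ d) * (Real.sqrt (2 * d) * (102 * (d + 1) ^ 2 * L)) := by positivity
  refine ⟨αs, j₁, 2 * BKc, κ / 4, hαs0, hj₁0, by positivity, by positivity, ?_⟩
  intro n η hηL c₀ c₁ _ _ hw hρ m _ hm U αU hα0 hα1 hαL hU1 hreg εU hεU hUε hLb α hα hαle hUst hUb hUη hpl hUgrad hRlev hεg hAQ hpos' hpos hc₀η j₀ hJ hj
    hposπ hQ v z F hzv hzF b'
  have hc₀ : (0 : ℝ) < c₀ := Fact.out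
  have hc₁ : (0 : ℝ) < c₁ := Fact.out
  haveI : Nonempty (Bond d m) := ⟨b'⟩
  have y₀ : TSite d (towerP L m (n + 1)) := fun _ => 0
  haveI : Nonempty (Bond d (towerP L m (n + 1))) := ⟨(y₀, b'.2)⟩
  have hF0 : 0 ≤ F := (norm_nonneg _).trans (hzF b')
  have hj₀0 : 0 ≤ j₀ := (norm_nonneg _).trans (hJ b'.2 y₀)
  have hαD_ : α ≤ αD := hαle.trans (by rw [hαs]; exact min_le_left _ _)
  have hαK_ : α ≤ αK := hαle.trans (by rw [hαs]; exact min_le_right _ _)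
  have hjD_ : j₀ ≤ jD := hj.trans hj₁D
  -- the families and the CLMs
  obtain ⟨rF, hrF⟩ := exists_block_clm_family (𝕜 := ℂ) (w := fun _ : Bond d m => c₁) (V := W) (fun c : Bond d m => bpos c)
  obtain ⟨PB, hPB⟩ := exists_block_clm_family (𝕜 := ℂ) (w := fun _ : Bond d (towerP L m (n + 1)) => c₀) (V := W)
    (fun x : Bond d (towerP L m (n + 1)) => blockCoord (L ^ (n + 1)) m (siteCast (towerP_eq_fineP_pow L m (n + 1)) (bpos x)))
  obtain ⟨K0cl, hK0cl⟩ : ∃ T : BondL2K ℂ d m c₁ W →L[ℂ] BondL2K ℂ d m c₁ W, T = LinearMap.toContinuousLinearMap (KinvLatticeK hpos hQ) := ⟨_, rfl⟩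
  obtain ⟨Kpcl, hKpcl⟩ : ∃ T : BondL2K ℂ d m c₁ W →L[ℂ] BondL2K ℂ d m c₁ W, T = LinearMap.toContinuousLinearMap (KinvLatticeK hposπ hQ) := ⟨_, rfl⟩
  obtain ⟨G0cl, hG0cl⟩ : ∃ T : BondL2K ℂ d (towerP L m (n + 1)) c₀ W →L[ℂ] BondL2K ℂ d (towerP L m (n + 1)) c₀ W,
      T = LinearMap.toContinuousLinearMap (G1k L m n φ η U hL αU hα1 hU1 hreg τ (c₀ := c₀) (c₁ := c₁) hpos) := ⟨_, rfl⟩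
  obtain ⟨Gtcl, hGtcl⟩ : ∃ T : BondL2K ℂ d (towerP L m (n + 1)) c₀ W →L[ℂ] BondL2K ℂ d (towerP L m (n + 1)) c₀ W,
      T = LinearMap.toContinuousLinearMap (G1LatticeK hposπ) := ⟨_, rfl⟩
  obtain ⟨Qcl, hQcl⟩ : ∃ T : BondL2K ℂ d (towerP L m (n + 1)) c₀ W →L[ℂ] BondL2K ℂ d m c₁ W, T = LinearMap.toContinuousLinearMap (QkW L m n φ U hL αU hα1 hU1 hreg (c₀ := c₀) (c₁ := c₁)) := ⟨_, rfl⟩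
  obtain ⟨Qacl, hQacl⟩ : ∃ T : BondL2K ℂ d m c₁ W →L[ℂ] BondL2K ℂ d (towerP L m (n + 1)) c₀ W,
      T = LinearMap.toContinuousLinearMap (LinearMap.adjoint (QkW L m n φ U hL αU hα1 hU1 hreg (c₀ := c₀) (c₁ := c₁))) := ⟨_, rfl⟩
  -- the resolvent identity `K̃ = K₀ + K₀E′K̃`
  have hAKid : ∀ y, QkW L m n φ U hL αU hα1 hU1 hreg (c₀ := c₀) (c₁ := c₁) (G1LatticeK hposπ (LinearMap.adjoint (QkW L m n φ U hL αU hα1 hU1 hreg (c₀ := c₀) (c₁ := c₁)) (KinvLatticeK hposπ hQ y))) = y := fun y => hK_lattice hposπ hQ y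
  have hKA : ∀ x, KinvLatticeK hpos hQ (QkW L m n φ U hL αU hα1 hU1 hreg (c₀ := c₀) (c₁ := c₁) (G1k L m n φ η U hL αU hα1 hU1 hreg τ (c₀ := c₀) (c₁ := c₁) hpos (LinearMap.adjoint (QkW L m n φ U hL αU hα1 hU1 hreg (c₀ := c₀) (c₁ := c₁)) x))) = x := fun x => by
    unfold KinvLatticeK B11Eq103H1Complex.KinvK G1k B11Eq103H1Complex.G1LatticeK
    exact greenK_apply _ x
  have hT : ∀ f, Kpcl f = K0cl f + K0cl ((Qcl ∘L (G0cl - Gtcl) ∘L Qacl) (Kpcl f)) := by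
    intro f
    simp only [hKpcl, hK0cl, hQcl, hG0cl, hGtcl, hQacl, ContinuousLinearMap.comp_apply, LinearMap.coe_toContinuousLinearMap']
    change _ = _ + KinvLatticeK hpos hQ (QkW L m n φ U hL αU hα1 hU1 hreg (c₀ := c₀) (c₁ := c₁) ((G1k L m n φ η U hL αU hα1 hU1 hreg τ (c₀ := c₀) (c₁ := c₁) hpos) (LinearMap.adjoint (QkW L m n φ U hL αU hα1 hU1 hreg (c₀ := c₀) (c₁ := c₁)) (KinvLatticeK hposπ hQ f)) -
      (G1LatticeK hposπ) (LinearMap.adjoint (QkW L m n φ U hL αU hα1 hU1 hreg (c₀ := c₀) (c₁ := c₁)) (KinvLatticeK hposπ hQ f))))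
    rw [map_sub, hAKid, ← map_add, add_sub_cancel, hKA]
  -- (L)(K₀; A_K√d, κ∕2) from the coarse block decay
  have hKblk : ∀ y₀ y₁, ‖rF y₁ ∘L K0cl ∘L rF y₀‖ ≤ AK * Real.exp (-(κ * tdist m y₀ y₁)) := by
    intro y₀ y₁
    rw [hK0cl]
    have h := HK n η hηL c₀ c₁ hw hρ m hm U αU hα0 hα1 hαL hU1 hreg εU hεU hUε hLb α hα hαK_ hUst hUb hUη hpl hεg hpos hQ rF hrF y₀ y₁
    exact h.trans (mul_le_mul_of_nonneg_left (exp_weaken' hκK (tdist_nonneg m _ _)) hAK)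
  have hμF : ∀ u : TSite d m, ∑ x : Bond d m, (if bpos x = u then c₁ else 0) ≤ (d : ℝ) * c₁ := by
    intro u
    rw [Fintype.sum_prod_type, Finset.sum_comm]
    have hin : ∀ μ : Fin d, ∑ y : TSite d m, (if bpos ((y, μ) : Bond d m) = u then c₁ else 0) = c₁ := fun μ => by
      simp only [show ∀ y : TSite d m, bpos ((y, μ) : Bond d m) = y from fun _ => rfl, Finset.sum_ite_eq', Finset.mem_univ, if_true]
    simp only [hin, Finset.sum_const, Finset.card_univ, Fintype.card_fin, nsmul_eq_mul, le_refl]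
  have hsd : AK * Real.sqrt ((d : ℝ) * c₁) / Real.sqrt c₁ = BKc := by
    rw [hBKc, Real.sqrt_mul (Nat.cast_nonneg d), mul_div_assoc, mul_div_cancel_right₀ _ (Real.sqrt_pos.2 hc₁).ne']
  have hK0L : ∀ (v : TSite d m) (z : BondL2K ℂ d m c₁ W) (F : ℝ), (∀ x, bpos x ≠ v → WL2.equiv ℂ (fun _ : Bond d m => c₁) W z x = 0) →
      (∀ x, ‖WL2.equiv ℂ (fun _ : Bond d m => c₁) W z x‖ ≤ F) →
      ∀ x, ‖WL2.equiv ℂ (fun _ : Bond d m => c₁) W (K0cl z) x‖ ≤ BKc * Real.exp (-(κ / 2 * tdist m (bpos x) v)) * F := by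
    intro v z F hzv hzF x
    have hF : 0 ≤ F := (norm_nonneg _).trans (hzF x)
    have h := letter_Kinv_of_block_decay (tdist m) (fun c : Bond d m => bpos c) hrF K0cl (fun u w => tdist_symm hm u w) hAK hc₁ (fun _ => le_rfl) hμF
      hKblk v z F hzv hzF x
    rw [hsd] at h
    exact h.trans (mul_le_mul_of_nonneg_right (mul_le_mul_of_nonneg_left (exp_weaken' (half_le_self hκ0.le) (tdist_nonneg m _ _)) hBKc0) hF)
  -- (L)(Q_k†; M_Q†·e^κ, κ): size from the single-bond letter, range `1`
  have hdiag : c₁ / c₀ * (Mφ' * ((((L : ℝ) ^ (n + 1)) ^ d)⁻¹ * Real.exp (100 * d * (d + 1) * (L : ℝ) ^ d * AQ)) * Mφ) * ((2 * d : ℕ) : ℝ) = MQa := by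
    have hLp : (0 : ℝ) < ((L : ℝ) ^ (n + 1)) ^ d := pow_pos (pow_pos (Nat.cast_pos.2 hL) _) _
    rw [hMQa, ← hw]
    field_simp
  have hQaM : ∀ (z : BondL2K ℂ d m c₁ W) (F : ℝ), (∀ x, ‖WL2.equiv ℂ (fun _ : Bond d m => c₁) W z x‖ ≤ F) →
      ∀ x, ‖WL2.equiv ℂ (fun _ : Bond d (towerP L m (n + 1)) => c₀) W (Qacl z) x‖ ≤ MQa * F := by
    intro z F hzF x
    have hF : 0 ≤ F := (norm_nonneg _).trans (hzF b')
    have h := norm_adjoint_QkW_apply_le_local_sharp L m n φ (c₀ := c₀) U hL αU hα0 hα1 hU1 hreg hMφ hφ hMφ' hφ' hAQ z x hF (fun c _ => hzF c)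
    rw [hQacl, LinearMap.coe_toContinuousLinearMap', ← hdiag]
    exact h
  have hQaρ : ∀ (v : TSite d m) (z : BondL2K ℂ d m c₁ W), (∀ x, bpos x ≠ v → WL2.equiv ℂ (fun _ : Bond d m => c₁) W z x = 0) →
      ∀ x, (1 : ℝ) < tdist m (blockCoord (L ^ (n + 1)) m (siteCast (towerP_eq_fineP_pow L m (n + 1)) (bpos x))) v →
        WL2.equiv ℂ (fun _ : Bond d (towerP L m (n + 1)) => c₀) W (Qacl z) x = 0 := by
    intro v z hzv x hx
    have hnear : ∀ c : Bond d m, (blockCoord (L ^ (n + 1)) m (siteCast (towerP_eq_fineP_pow L m (n + 1)) x.1) = c.1 ∨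
        blockCoord (L ^ (n + 1)) m (siteCast (towerP_eq_fineP_pow L m (n + 1)) x.1) = shift c.2 c.1) →
        ‖WL2.equiv ℂ (fun _ : Bond d m => c₁) W z c‖ ≤ 0 := by
      intro c hc
      have hcv : bpos c ≠ v := by
        intro hcv
        rcases hc with h1 | h2
        · have : tdist m (blockCoord (L ^ (n + 1)) m (siteCast (towerP_eq_fineP_pow L m (n + 1)) (bpos x))) v = 0 := by
            rw [show bpos x = x.1 from rfl, h1, show c.1 = bpos c from rfl, hcv, tdist_self]
          linarith only [this, hx]
        · have : tdist m (blockCoord (L ^ (n + 1)) m (siteCast (towerP_eq_fineP_pow L m (n + 1)) (bpos x))) v ≤ 1 := by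
            rw [show bpos x = x.1 from rfl, h2, show c.1 = bpos c from rfl, hcv, tdist_symm hm]
            exact tdist_shift_le_one hm v c.2
          linarith only [this, hx]
      rw [hzv c hcv, norm_zero]
    have h := norm_adjoint_QkW_apply_le_local_sharp L m n φ (c₀ := c₀) U hL αU hα0 hα1 hU1 hreg hMφ hφ hMφ' hφ' hAQ z x le_rfl hnear
    rw [mul_zero] at h
    rw [hQacl, LinearMap.coe_toContinuousLinearMap']
    exact norm_le_zero_iff.1 h
  have hQa := letter_of_range (tdist m) (fun c : Bond d m => bpos c) (fun x : Bond d (towerP L m (n + 1)) => blockCoord (L ^ (n + 1)) m (siteCast (towerP_eq_fineP_pow L m (n + 1)) (bpos x))) Qacl (M := MQa) (ρ := 1)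
    (κ := κ) hκ0.le hQaM hQaρ
  -- (L)(Q_k; C_Q·2√d·e^κ, κ): size from the block letter (height-free through the window), range `1`
  have hμB : ∀ u : TSite d m, ∑ x : Bond d (towerP L m (n + 1)), (if blockCoord (L ^ (n + 1)) m (siteCast (towerP_eq_fineP_pow L m (n + 1)) (bpos x)) = u then c₀ else 0) ≤ (d : ℝ) * c₁ := by
    intro u
    have h := sum_bondMass_bigBlock_le L m n hc₀.le u
    calc _ ≤ c₀ * (d * ((L : ℝ) ^ (n + 1)) ^ d) := h
      _ = (d : ℝ) * c₁ := by rw [← hw]; ring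
  have hblk : ∀ (u : BondL2K ℂ d (towerP L m (n + 1)) c₀ W) (F : ℝ), 0 ≤ F →
      (∀ x, ‖WL2.equiv ℂ (fun _ : Bond d (towerP L m (n + 1)) => c₀) W u x‖ ≤ F) → ∀ y : TSite d m, ‖PB y u‖ ≤ Real.sqrt ((d : ℝ) * c₁) * F := by
    intro u F hF huF y
    refine norm_le_sqrt_mass_mul (w := fun _ : Bond d (towerP L m (n + 1)) => c₀) (π := fun x : Bond d (towerP L m (n + 1)) => blockCoord (L ^ (n + 1)) m (siteCast (towerP_eq_fineP_pow L m (n + 1)) (bpos x)))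
      y (hμB y) (PB y u) hF (fun x hx => ?_) (fun x => ?_)
    · rw [hPB, if_neg hx]
    · rw [hPB]
      by_cases hx : blockCoord (L ^ (n + 1)) m (siteCast (towerP_eq_fineP_pow L m (n + 1)) (bpos x)) = y
      · rw [if_pos hx]; exact huF x
      · rw [if_neg hx, norm_zero]; exact hF
  have hsd2 : Real.sqrt ((d : ℝ) * c₁) = Real.sqrt d * Real.sqrt c₁ := Real.sqrt_mul (Nat.cast_nonneg d) c₁
  have hsc : 0 < Real.sqrt c₁ := Real.sqrt_pos.2 hc₁
  have hexpα : Real.exp (Real.sqrt ((L : ℝ) ^ d) * (Real.sqrt (2 * d) * (102 * (d + 1) ^ 2 * L)) * (α / (1 - ϱ))) ≤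
      Real.exp (Real.sqrt ((L : ℝ) ^ d) * (Real.sqrt (2 * d) * (102 * (d + 1) ^ 2 * L)) * (αs / (1 - ϱ))) :=
    Real.exp_le_exp.2 (mul_le_mul_of_nonneg_left (div_le_div_of_nonneg_right hαle h1ϱ.le) hW0)
  have hQM : ∀ (u : BondL2K ℂ d (towerP L m (n + 1)) c₀ W) (F : ℝ), (∀ x, ‖WL2.equiv ℂ (fun _ : Bond d (towerP L m (n + 1)) => c₀) W u x‖ ≤ F) →
      ∀ c, ‖WL2.equiv ℂ (fun _ : Bond d m => c₁) W (Qcl u) c‖ ≤ CQ * (2 * Real.sqrt d) * F := by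
    intro u F huF c
    have hF : 0 ≤ F := (norm_nonneg _).trans (huF (y₀, b'.2))
    have h := norm_equiv_QkW_apply_le_blocks L m n φ U hL αU hα1 hU1 hreg hMφ hφ hMφ' hφ' εU hεU hUε hϱ0 hϱ1 hα hεg hPB hw.symm u c
    have h1 := hblk u F hF huF c.1
    have h2 := hblk u F hF huF (shift c.2 c.1)
    rw [hQcl, LinearMap.coe_toContinuousLinearMap']
    refine h.trans ?_
    calc Mφ' * Mφ * Real.exp (Real.sqrt ((L : ℝ) ^ d) * (Real.sqrt (2 * d) * (102 * (d + 1) ^ 2 * L)) * (α / (1 - ϱ))) / Real.sqrt c₁ *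
          (‖PB c.1 u‖ + ‖PB (shift c.2 c.1) u‖)
        ≤ Mφ' * Mφ * Real.exp (Real.sqrt ((L : ℝ) ^ d) * (Real.sqrt (2 * d) * (102 * (d + 1) ^ 2 * L)) * (αs / (1 - ϱ))) / Real.sqrt c₁ *
          (Real.sqrt ((d : ℝ) * c₁) * F + Real.sqrt ((d : ℝ) * c₁) * F) := by
          refine mul_le_mul ?_ (add_le_add h1 h2) (add_nonneg (norm_nonneg _) (norm_nonneg _)) (div_nonneg (hCQ ▸ hCQ0) hsc.le)
          exact div_le_div_of_nonneg_right (mul_le_mul_of_nonneg_left hexpα (mul_nonneg hMφ' hMφ)) hsc.le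
      _ = CQ * (2 * Real.sqrt d) * F := by
          rw [hCQ, hsd2]
          field_simp
          ring
  have hQρ : ∀ (v : TSite d m) (u : BondL2K ℂ d (towerP L m (n + 1)) c₀ W),
      (∀ x, blockCoord (L ^ (n + 1)) m (siteCast (towerP_eq_fineP_pow L m (n + 1)) (bpos x)) ≠ v → WL2.equiv ℂ (fun _ : Bond d (towerP L m (n + 1)) => c₀) W u x = 0) →
      ∀ c : Bond d m, (1 : ℝ) < tdist m (bpos c) v → WL2.equiv ℂ (fun _ : Bond d m => c₁) W (Qcl u) c = 0 := by
    intro v u huv c hc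
    have h1 : c.1 ≠ v := by
      intro h1
      have : tdist m (bpos c) v = 0 := by rw [show bpos c = c.1 from rfl, h1, tdist_self]
      linarith only [this, hc]
    have h2 : shift c.2 c.1 ≠ v := by
      intro h2
      have : tdist m (bpos c) v ≤ 1 := by rw [show bpos c = c.1 from rfl, ← h2]; exact tdist_shift_le_one hm c.1 c.2
      linarith only [this, hc]
    rw [hQcl, LinearMap.coe_toContinuousLinearMap', equiv_QkW_apply,
      QkOfU_apply_eq_zero_of_support L m hL (n + 1) U αU hα1 hU1 hreg v _ (fun x hx => by rw [huv x hx, map_zero]) c h1 h2, map_zero]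
  have hQf := letter_of_range (tdist m) (fun x : Bond d (towerP L m (n + 1)) => blockCoord (L ^ (n + 1)) m (siteCast (towerP_eq_fineP_pow L m (n + 1)) (bpos x))) (fun c : Bond d m => bpos c) Qcl (M := CQ * (2 * Real.sqrt d))
    (ρ := 1) (κ := κ) hκ0.le hQM hQρ
  -- (L)(G1k − G̃_k; j₀·C_D, κ) ((K79), sign flipped)
  have hDf : ∀ (v : TSite d m) (f : BondL2K ℂ d (towerP L m (n + 1)) c₀ W) (F : ℝ),
      (∀ x, blockCoord (L ^ (n + 1)) m (siteCast (towerP_eq_fineP_pow L m (n + 1)) (bpos x)) ≠ v → WL2.equiv ℂ (fun _ : Bond d (towerP L m (n + 1)) => c₀) W f x = 0) →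
      (∀ x, ‖WL2.equiv ℂ (fun _ : Bond d (towerP L m (n + 1)) => c₀) W f x‖ ≤ F) →
      ∀ x, ‖WL2.equiv ℂ (fun _ : Bond d (towerP L m (n + 1)) => c₀) W ((G0cl - Gtcl) f) x‖ ≤
        j₀ * CD * Real.exp (-(κ * tdist m (blockCoord (L ^ (n + 1)) m (siteCast (towerP_eq_fineP_pow L m (n + 1)) (bpos x))) v)) * F := by
    intro v f F hfv hfF x
    have hF : 0 ≤ F := (norm_nonneg _).trans (hfF x)
    have h := (HD n η hηL c₀ c₁ hw hρ m hm U αU hα0 hα1 hU1 hreg εU hεU hUε hLb α hα hαD_ hUst hUb hUη hpl hUgrad hRlev hεg hAQ hpos' hpos hc₀η j₀ hJ hjD_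
      hposπ v f F hfv hfF x x.1).1
    have e : WL2.equiv ℂ (fun _ : Bond d (towerP L m (n + 1)) => c₀) W ((G0cl - Gtcl) f) x =
        WL2.equiv ℂ (fun _ : Bond d (towerP L m (n + 1)) => c₀) W (G1k L m n φ η U hL αU hα1 hU1 hreg τ (c₀ := c₀) (c₁ := c₁) hpos f) x -
          WL2.equiv ℂ (fun _ : Bond d (towerP L m (n + 1)) => c₀) W (G1LatticeK hposπ f) x := by
      rw [hG0cl, hGtcl]; rfl
    rw [WL2.equiv_sub, Pi.sub_apply] at h
    rw [e, norm_sub_rev]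
    exact h.trans (mul_le_mul_of_nonneg_right (mul_le_mul_of_nonneg_left (exp_weaken' hκD (tdist_nonneg m _ _)) (mul_nonneg hj₀0 hCD)) hF)
  -- (L)(E′; j₀·C_E, κ∕2), `E′ = Q_k ∘ (G1k − G̃_k) ∘ Q_k†`
  have hgap : 0 < κ - κ / 2 := sub_pos.2 (half_lt_self hκ0)
  have hS : ∀ w' : TSite d m, ∑ u : TSite d m, Real.exp (-((κ - κ / 2) * tdist m w' u)) ≤ K := fun w' => by
    rw [hKdef]; exact torusSum_le d hm hgap w'
  have hMQ1 : 0 ≤ MQa * Real.exp (κ * 1) := mul_nonneg hMQa0 (Real.exp_nonneg _)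
  have c1 := letter_comp (tdist m) (fun c : Bond d m => bpos c) (fun x : Bond d (towerP L m (n + 1)) => blockCoord (L ^ (n + 1)) m (siteCast (towerP_eq_fineP_pow L m (n + 1)) (bpos x)))
    (fun x : Bond d (towerP L m (n + 1)) => blockCoord (L ^ (n + 1)) m (siteCast (towerP_eq_fineP_pow L m (n + 1)) (bpos x))) Qacl (G0cl - Gtcl) (tdist_nonneg m) (fun u y w' => tdist_triangle hm u y w')
    (B₁ := MQa * Real.exp (κ * 1)) (B₂ := j₀ * CD) (κ₁ := κ) (κ₂ := κ) (κ' := κ / 2) (S := K) hMQ1 (mul_nonneg hj₀0 hCD) (half_pos hκ0).le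
    (half_le_self hκ0.le) hQa hDf hS
  have c2 := letter_comp (tdist m) (fun c : Bond d m => bpos c) (fun x : Bond d (towerP L m (n + 1)) => blockCoord (L ^ (n + 1)) m (siteCast (towerP_eq_fineP_pow L m (n + 1)) (bpos x))) (fun c : Bond d m => bpos c)
    ((G0cl - Gtcl) ∘L Qacl) Qcl (tdist_nonneg m) (fun u y w' => tdist_triangle hm u y w')
    (B₁ := MQa * Real.exp (κ * 1) * (j₀ * CD) * K) (B₂ := CQ * (2 * Real.sqrt d) * Real.exp (κ * 1)) (κ₁ := κ / 2) (κ₂ := κ) (κ' := κ / 2) (S := K)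
    (mul_nonneg (mul_nonneg hMQ1 (mul_nonneg hj₀0 hCD)) hK0) (mul_nonneg (mul_nonneg hCQ0 (mul_nonneg zero_le_two (Real.sqrt_nonneg _))) (Real.exp_nonneg _))
    (half_pos hκ0).le le_rfl c1 hQf hS
  have hEL : ∀ (v : TSite d m) (z : BondL2K ℂ d m c₁ W) (F : ℝ), (∀ x, bpos x ≠ v → WL2.equiv ℂ (fun _ : Bond d m => c₁) W z x = 0) →
      (∀ x, ‖WL2.equiv ℂ (fun _ : Bond d m => c₁) W z x‖ ≤ F) →
      ∀ x, ‖WL2.equiv ℂ (fun _ : Bond d m => c₁) W ((Qcl ∘L (G0cl - Gtcl) ∘L Qacl) z) x‖ ≤ j₀ * CE * Real.exp (-(κ / 2 * tdist m (bpos x) v)) * F := by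
    intro v z F hzv hzF x
    have h := c2 v z F hzv hzF x
    have e : MQa * Real.exp (κ * 1) * (j₀ * CD) * K * (CQ * (2 * Real.sqrt d) * Real.exp (κ * 1)) * K = j₀ * CE := by rw [hCE]; ring
    rw [← e]
    exact h
  -- (K71): the Neumann series at rate `κ∕2 → κ∕4`
  have hS' : ∀ w' : TSite d m, ∑ u : TSite d m, Real.exp (-((κ / 2 - κ / 4) * tdist m w' u)) ≤ K' := fun w' => by
    rw [hK'def]; exact torusSum_le d hm (by linarith only [hκ0]) w'
  have hq2 : j₀ * CE * K' * BKc * K' ≤ 1 / 2 := by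
    calc j₀ * CE * K' * BKc * K' = j₀ * P := by rw [hP]; ring
      _ ≤ j₁ * P := mul_le_mul_of_nonneg_right (hj.trans le_rfl) hP0
      _ ≤ 1 / 2 := hj₁P
  have hq : j₀ * CE * K' * BKc * K' < 1 := lt_of_le_of_lt hq2 (by norm_num)
  have h := letter_of_neumann' (tdist m) (fun c : Bond d m => bpos c) K0cl (Qcl ∘L (G0cl - Gtcl) ∘L Qacl) Kpcl (tdist_nonneg m)
    (fun u y w' => tdist_triangle hm u y w') hT hBKc0 (mul_nonneg hj₀0 hCE0) (by linarith only [hκ0] : (0 : ℝ) ≤ κ / 4) (by linarith only [hκ0] : κ / 4 < κ / 2)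
    hK0L hEL hS' hq
    v z F hzv hzF b'
  rw [hKpcl, LinearMap.coe_toContinuousLinearMap'] at h
  refine h.trans (mul_le_mul_of_nonneg_right (mul_le_mul_of_nonneg_right ?_ (Real.exp_nonneg _)) hF0)
  have h1 : (1 : ℝ) / 2 ≤ 1 - j₀ * CE * K' * BKc * K' := by linarith only [hq2]
  calc BKc / (1 - j₀ * CE * K' * BKc * K') ≤ BKc / (1 / 2) := div_le_div_of_nonneg_left hBKc0 (by norm_num) h1
    _ = 2 * BKc := by ring

end Literature.MathematicalPhysics.QuantumFieldTheory.Balaban1983to89.B9Eq3132QGtildeQInvLetterClosed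

end
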